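import Literature.AlgebraicGeometry.HodgeTheory.BettiUniverseKunnethHodge
import Literature.AlgebraicGeometry.HodgeTheory.BettiUniverseKunnethHodgePowersNormalForm
import Literature.AlgebraicGeometry.HodgeTheory.BettiHardLefschetzHodgeMorphisms
import Literature.AlgebraicGeometry.HodgeTheory.BettiKunnethHodgeClassesAlgebraicClasses
import Literature.AlgebraicGeometry.HodgeTheory.BettiKunnethHodgeClassesHodgeMorphisms
import Literature.AlgebraicGeometry.HodgeTheory.BettiPicardNumberBounds
import Literature.AlgebraicGeometry.HodgeTheory.BettiHodgeGroupMinusIdentityParity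
import Literature.AlgebraicGeometry.HodgeTheory.BettiHodgeConjectureStandardASmallDimensions
import Literature.AlgebraicGeometry.HodgeTheory.BettiHodgeGroupTrivialPureTypeDegrees
import Literature.AlgebraicGeometry.HodgeTheory.AlgebraicClassesCupAbelianVarietyDiagonal
import Literature.AlgebraicGeometry.HodgeTheory.AlgebraicClassesPullbackOfCupProduct
import Literature.AlgebraicGeometry.Motives.HodgeStructureTensorPureType
import Literature.AlgebraicGeometry.Motives.HodgeStructureAbelianTypeDirectSum
import Literature.AlgebraicGeometry.Motives.HodgeStructureTensorPowerDual
import Literature.AlgebraicGeometry.Motives.HodgeTensorFactsHolds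
import Literature.AlgebraicTopology.SingularHomology.CupProductProofs
import HarnessLib

/-!
# The odd Künneth components of the Hodge classes on a product with a surface are algebraic: `Hdg²(H¹(Y) ⊗ H³(S))`, `Hdg²(H³(S) ⊗ H¹(Z))` consist of classes `pr_S^* η ∪ (divisor class)`
# (hard Lefschetz `H¹(S) ≅ H³(S)` + Lefschetz `(1,1)`), hence — modulo Fulton's «pull-backs preserve algebraic classes» — `HC(S × S')` for two surfaces REDUCES TO THE PIECE `H²(S) ⊗ H²(S')`;
# in particular `HC(S × S')` whenever `p_g(S) = 0` or `p_g(S') = 0`, with no condition on the irregularities (Voisin I Thm. 11.38–11.40, Lemma 11.41, Thm. 6.25, Thm. 11.30)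

Family `hodge`, lane `lit-hodgefound` (Track 2 foundations library; Layers A2/A4), layer `Literature/AlgebraicGeometry/HodgeTheory`.  THEOREMS ONLY (no definition, no named fact, no instance;
D-0026 net debt `0`).  The cup-product steps are taken modulo the tree's named fact `fulton1998_map_mem_algebraicClasses` (Fulton 1998 Prop. 19.1.2 / Voisin II Prop. 9.21: pull-backs along
morphisms of smooth projective varieties preserve algebraic classes; equivalent to Voisin's «the cup product of algebraic classes is algebraic», the tree's `cupProduct_algebraicClasses_of_fulton1998`),
threaded as the hypothesis `hF` exactly as in the tree's `BettiUniverseKunnethHodgePowersNormalForm` (`ofRatClass_bettiCup_mem_algebraicClasses`); it is discharged summit-side.  Each statement is also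
given in a form `…_of_cupProduct` whose only extra hypothesis `hcup` is the cup-closure of the DIVISOR classes of the product in question (codimension `1 + 1`), which the tree PROVES for abelian
varieties (`AbelianVariety.cupProduct_mem_algebraicClasses`): so for two abelian surfaces the results are unconditional (§4).  Sequel of the seat's
g27-#9 (`BettiHodgeConjectureProductOfSurfaces`: `HC(S ⊗ S')` under `Hom_HS(H¹S, H³S'(1)) = 0 = Hom_HS(H³S, H¹S'(−1))` and the `(2,2)`-condition) and g28-#1 (`BettiHardLefschetzHodgeMorphisms`: `Lᵗ` is
a morphism of Hodge structures, an isomorphism in the hard Lefschetz range).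

THE MATHEMATICS.  Let `S` be a smooth projective surface with rational Kähler class `η` and `Y` any smooth projective variety.  Hard Lefschetz `L = η ∪ · : H¹(S) ⥲ H³(S)` is an isomorphism of
`ℚ`-Hodge structures `H¹(S) ⥲ H³(S)(1)` (Thm. 6.25 + Rem. 6.27), so `id ⊗ L : H¹(Y) ⊗ H¹(S) ⥲ H¹(Y) ⊗ H³(S)(1)` carries `Hdg¹(H¹(Y) ⊗ H¹(S))` ONTO `Hdg²(H¹(Y) ⊗ H³(S))`.  Under the Künneth map
(Thm. 11.38, an isomorphism of Hodge structures, Thm. 11.40) a class `u ∈ Hdg¹(H¹(Y) ⊗ H¹(S))` goes to a rational `(1,1)`-class of `H²(Y × S)` — a divisor class (Lefschetz `(1,1)`, Thm. 11.30) —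
and `(id ⊗ L) u` goes to `pr_Y^* a ∪ pr_S^*(η ∪ b) = pr_S^* η ∪ (pr_Y^* a ∪ pr_S^* b)` (associativity and graded commutativity of `∪`): the cup product of the divisor class `pr_S^* η` with a divisor
class, an algebraic class of codimension `2` (Fulton).  Symmetrically for `H³(S) ⊗ H¹(Z)`.  For two surfaces the Künneth pieces of `H⁴(S × S')` are `H⁰⊗H⁴`, `H¹⊗H³`, `H²⊗H²`, `H³⊗H¹`, `H⁴⊗H⁰`;
the outer two carry only products of algebraic classes, the odd two are algebraic by the above, so `HC(S × S')` (`⟺ HC²(S × S')`, codimensions `0, 1, 3, 4` being free) holds as soon as the Hodge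
classes of the piece `H²(S) ⊗ H²(S')` are algebraic — e.g. when they are spanned by products of divisor classes (`dim Hom_HS(H²S, H²S') ≤ ρ(S)ρ(S')`, g27-#9's condition), which is automatic when
`p_g(S) = 0` or `p_g(S') = 0` (`H²` of pure type `(1,1)`: Deligne 2.1.13, the tree's `hodgeClasses_tensor_eq_span_of_hodgeClasses_eq_top`).  The remaining, genuinely open, part of `HC(S × S')` is
thus the algebraicity of the morphisms of Hodge structures between the transcendental lattices `T(S) → T(S')` (e.g. `S = S'` a K3 surface: Mukai, Nikulin, Buskin).

THE PRINTS.  C. Voisin (2002) [VoisinHodgeI2002] §11.3.3 Thm. 11.38 (Künneth), Def. 11.39, Thm. 11.40, Lemma 11.41 (p. 286), p. 287; §6.2.3 Thm. 6.25 (hard Lefschetz), Rem. 6.27 (`L` of bidegree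
`(1,1)`); §7.3.1 Lemma 7.23; §11.3.1 Thm. 11.30 (Lefschetz `(1,1)`); §11.3.2 (the Hodge conjecture).  W. Fulton (1998) [Fulton1998] §19.1 Prop. 19.1.2 and Cor. 19.2 (b).  C. Voisin (2003)
[VoisinHodgeII2003] §9.2.2 Prop. 9.20–9.21.  P. Deligne (1971) [DeligneHodgeII1971] 2.1, 1.1.12, 2.1.13–2.1.14.  P. Deligne (2000) [Deligne2000] §1 (the statement of the conjecture, codimensions
`≤ 1` and `≥ n − 1`).  A. Hatcher (2002) [HatcherAT2002] §3.2 Prop. 3.10, Thm. 3.11 (naturality, graded commutativity of `∪`).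

THE OBJECTS (all the tree's).  `Y Z S S' : SchemeOver ℂ`, `hS : IsSmoothProjective 2 S` (a surface), `Y ⊗ S = Y ×_ℂ S`; `Hᵏ(X) = BettiUniverse.hodge hHD hX k`; the Künneth summand
`BettiUniverse.kunnethSummand hHD hY hS (2·2) ⟨(i, j), _⟩` (`Hⁱ(Y) ⊗ Hʲ(S)` as a `ℚ`-Hodge structure of weight `4`) and the cross product `BettiUniverse.crossMap Y S _ : Hⁱ(Y;ℚ) ⊗ Hʲ(S;ℚ) → H⁴(Y ⊗ S;ℚ)`
(`y ⊗ z ↦ pr₁^* y ∪ pr₂^* z`); `ofRatClass` (`Hᵏ(−;ℚ) → Hᵏ(−;ℂ)`), `algebraicClasses X p ⊆ H^{2p}(X(ℂ); ℂ)`, `HodgeConjectureFor`; `KaehlerRationalDatum 2 S` (`D.η ∈ H²(S(ℂ); ℚ)`), `lefschetzPowTo`;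
`hF : fulton1998_map_mem_algebraicClasses` (named fact of `AlgebraicClassesPullback`).

WHAT IS PROVED.
* §1 THE PIECE `H¹(Y) ⊗ H³(S)`: for every Hodge class `t` of the Künneth summand `H¹(Y) ⊗ H³(S)` of `H⁴(Y ⊗ S)`, `crossMap t ⊗ 1 ∈ N²H⁴(Y ⊗ S)` is ALGEBRAIC, granted `hF`
  (`BettiUniverse.ofRatClass_crossMap_mem_algebraicClasses_of_hodge_one_tensor_three`); the cup identity `crossMap ((id ⊗ L) u) = pr₂^* η ∪ crossMap u` (private `crossMap_map_id_lefschetz_right`).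
* §2 THE PIECE `H³(S) ⊗ H¹(Z)`: the mirror statement (`BettiUniverse.ofRatClass_crossMap_mem_algebraicClasses_of_hodge_three_tensor_one`).
* §3 PRODUCTS OF TWO SURFACES (granted `hF`, or the cup-closure `hcup` of the divisor classes of `S × S'` — the `…_of_cupProduct` forms): **`HC(S ⊗ S')` as soon as the Hodge classes of the piece `H²(S) ⊗ H²(S')` map to algebraic classes** (`BettiUniverse.hodgeConjectureFor_tensor_surfaces_of_kunneth_two_two`);
  **`HC(S ⊗ S')` if `dim_ℚ Hom_HS(H²(S), H²(S')) ≤ ρ(S)ρ(S')`** (`…_of_finrank_hom_le_of_fulton` — g27-#9's theorem without its two `H¹ ⊗ H³` conditions); **`HC(S ⊗ S')` if `p_g(S) = 0` or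
  `p_g(S') = 0`** (`…_of_pg_zero_left_of_fulton`, `…_right…`), in particular `HC(S ⊗ S)` for every surface with `p_g(S) = 0` (`BettiUniverse.hodgeConjectureFor_tensor_self_of_pg_zero_of_fulton`) —
  irregular surfaces included (ruled surfaces over curves of any genus, bielliptic surfaces, surfaces with `p_g = 0 < q`, …).
* §4 TWO ABELIAN SURFACES, UNCONDITIONALLY: **`HC(A × A')` whenever `dim_ℚ Hom_HS(H²(A), H²(A')) ≤ ρ(A)ρ(A')`** (`AbelianVariety.hodgeConjectureFor_prod_surfaces_of_finrank_hom_le`) and the membership form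
  (`AbelianVariety.hodgeConjectureFor_prod_surfaces_of_kunneth_two_two`) — no `hF`.

DEVIATIONS / SCOPE.  Everything in §1–§3 that uses a cup product of two algebraic classes is stated modulo `hF` (the tree proves the cup-closure for abelian varieties only); the Lefschetz `(1,1)` and
hard Lefschetz inputs are the tree's theorems.  The higher analogue (`H¹(Y) ⊗ H^{2n−1}(Z)` via `L^{n−1}`) is not treated here.

## References
* [VoisinHodgeI2002] C. Voisin, *Hodge Theory and Complex Algebraic Geometry I* (2002) — §11.3.3 Thm. 11.38, Thm. 11.40, Lemma 11.41 (pp. 285–287); §6.2.3 Thm. 6.25, Rem. 6.27; §7.3.1 Lemma 7.23;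
  §11.3.1 Thm. 11.30; §11.3.2.
* [Fulton1998] W. Fulton, *Intersection Theory*, 2nd ed. (1998) — §19.1 Prop. 19.1.2; Cor. 19.2 (b).
* [VoisinHodgeII2003] C. Voisin, *Hodge Theory and Complex Algebraic Geometry II* (2003) — §9.2.2 Prop. 9.20–9.21.
* [DeligneHodgeII1971] P. Deligne, *Théorie de Hodge II* (1971) — 2.1; 1.1.12; 2.1.13–2.1.14.
* [Deligne2000] P. Deligne, *The Hodge conjecture* (Clay, 2000) — §1.
* [HatcherAT2002] A. Hatcher, *Algebraic Topology* (2002) — §3.2 Prop. 3.10, Thm. 3.11, Thm. 3.15–3.16.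

## Provenance
Lane `lit-hodgefound` (Hodge path, Track 2), prover seat `lit-hodgefound-p29` (generation 28), self-proposed row g28-#7 (closing the seat's g27-#9/#12 and g28-#1 line on `HC(S × S')`: the odd
Künneth conditions are removed, modulo Fulton's pull-back lemma); revision g28-#9 (same seat): the `…_of_cupProduct` forms and the unconditional §4 for two abelian surfaces.
-/

noncomputable section

open scoped TensorProduct
open CategoryTheory MonoidalCategory CartesianMonoidalCategory Module Finset
open Literature.AlgebraicTopology.SingularHomology
open Literature.Geometry.Kaehler

namespace Literature.AlgebraicGeometry.HodgeTheory

open Literature.AlgebraicGeometry.Motives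
open Literature.AlgebraicGeometry.Motives.HodgeStructure

variable {m n d : ℕ} {Y Z S S' : SchemeOver ℂ}

/-! ### §1 The piece `H¹(Y) ⊗ H³(S)` (`S` a surface) -/

/-- `L_η b = η ∪ b` on `H¹(S;ℚ)` (one Lefschetz step; private unfolding). [cite: VoisinHodgeI2002, §6.2.3 (6.7)] -/
private theorem lefschetzPowTo_one_one_three_apply (η : bettiCohomology S 2) (b : bettiCohomology S 1) :
    lefschetzPowTo η 1 1 3 rfl b = bettiCup (rfl : 2 + 1 = 3) η b := by
  rw [lefschetzPowTo_succ_apply η 0 1 1 3 rfl rfl rfl, lefschetzPowTo_zero_apply, lefschetzOperator_apply]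

/-- **The cup identity `pr_Y^* a ∪ pr_S^*(η ∪ b) = pr_S^* η ∪ (pr_Y^* a ∪ pr_S^* b)`** for `a ∈ H¹(Y)`, `b ∈ H¹(S)`, `η ∈ H²(S)` (naturality, associativity and graded commutativity of `∪`, the sign being
`(−1)^{1·2} = 1`), extended linearly: `crossMap ∘ (id ⊗ L_η) = (pr_S^* η ∪ ·) ∘ crossMap` on `H¹(Y;ℚ) ⊗ H¹(S;ℚ)`. [cite: HatcherAT2002, §3.2 Prop. 3.10 and Thm. 3.11] [cite: VoisinHodgeI2002, §11.3.3 Thm. 11.38] -/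
private theorem crossMap_map_id_lefschetz_right (η : bettiCohomology S 2) (u : bettiCohomology Y 1 ⊗[ℚ] bettiCohomology S 1) :
    BettiUniverse.crossMap Y S (show 1 + 3 = 2 * 2 by norm_num) (TensorProduct.map LinearMap.id (lefschetzPowTo η 1 1 3 rfl) u) =
      bettiCup (show 2 + 2 = 2 * 2 by norm_num) (BettiUniverse.pull (snd Y S) 2 η) (BettiUniverse.crossMap Y S (rfl : 1 + 1 = 2) u) := by
  induction u using TensorProduct.induction_on with
  | zero => rw [map_zero, map_zero, map_zero, map_zero]
  | tmul a b =>
    rw [TensorProduct.map_tmul, LinearMap.id_apply, lefschetzPowTo_one_one_three_apply, BettiUniverse.crossMap_tmul, BettiUniverse.crossMap_tmul,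
      show BettiUniverse.pull (snd Y S) 3 (bettiCup (rfl : 2 + 1 = 3) η b) = bettiCup (rfl : 2 + 1 = 3) (BettiUniverse.pull (snd Y S) 2 η) (BettiUniverse.pull (snd Y S) 1 b) from
        bettiCup_map (snd Y S) rfl η b,
      ← bettiCup_assoc (show 1 + 2 = 3 by norm_num) (rfl : 2 + 1 = 3) (show 3 + 1 = 2 * 2 by norm_num) (show 1 + 3 = 2 * 2 by norm_num),
      bettiCup_gradedComm (cupProduct_gradedComm_holds _ _) (show 1 + 2 = 3 by norm_num) (rfl : 2 + 1 = 3) (BettiUniverse.pull (fst Y S) 1 a) (BettiUniverse.pull (snd Y S) 2 η),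
      show ((-1 : ℚ) ^ (1 * 2)) = 1 by norm_num, one_smul,
      bettiCup_assoc (rfl : 2 + 1 = 3) (rfl : 1 + 1 = 2) (show 3 + 1 = 2 * 2 by norm_num) (show 2 + 2 = 2 * 2 by norm_num)]
  | add x y hx hy => rw [map_add, map_add, hx, hy, map_add, map_add]

/-- **The Hodge classes of the Künneth piece `H¹(Y) ⊗ H³(S)` of `H⁴(Y × S)` are algebraic** (`S` a smooth projective surface, `Y` any smooth projective variety), granted that the cup product of two
divisor classes of `Y × S` is algebraic (`hcup`; true for abelian varieties by the tree's `AbelianVariety.cupProduct_mem_algebraicClasses`, in general Fulton's Prop. 19.1.2 — see the `hF` form below): for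
`t ∈ Hdg²(H¹(Y) ⊗ H³(S))`, the class `crossMap t = Σ pr_Y^* yᵢ ∪ pr_S^* zᵢ ∈ H⁴(Y × S; ℚ)` is algebraic.  Proof as printed above: `t = (id ⊗ L_η) u` with `u ∈ Hdg¹(H¹(Y) ⊗ H¹(S))` (hard Lefschetz on `S` as an
isomorphism of Hodge structures `H¹(S) ⥲ H³(S)(1)`), `crossMap u` is a rational `(1,1)`-class of `Y × S` hence a divisor class, and `crossMap t = pr_S^* η ∪ crossMap u` is a cup product of two divisor classes.
[cite: VoisinHodgeI2002, §6.2.3 Thm. 6.25 and Rem. 6.27, §11.3.1 Thm. 11.30, §11.3.3 Thm. 11.38–11.40 and p. 287] [cite: Fulton1998, §19.1 Prop. 19.1.2 and Cor. 19.2 (b)] [cite: VoisinHodgeII2003, §9.2.2 Prop. 9.20–9.21] -/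
theorem BettiUniverse.ofRatClass_crossMap_mem_algebraicClasses_of_hodge_one_tensor_three_of_cupProduct [HodgeTensorFacts.{0, 0}] (hHD : exists_isReal_hodgeModel)
    (hY : IsSmoothProjective m Y) (hS : IsSmoothProjective 2 S) (hYS : IsSmoothProjective d (Y ⊗ S))
    (hcup : ∀ ⦃x y : complexBetti (Y ⊗ S) (2 * 1)⦄, x ∈ algebraicClasses (Y ⊗ S) 1 → y ∈ algebraicClasses (Y ⊗ S) 1 →
      cupProduct (two_mul_add_two_mul 1 1) x y ∈ algebraicClasses (Y ⊗ S) (1 + 1))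
    {t : bettiCohomology Y 1 ⊗[ℚ] bettiCohomology S 3} (ht : t ∈ (BettiUniverse.kunnethSummand hHD hY hS (2 * 2) ⟨(1, 3), HasAntidiagonal.mem_antidiagonal.2 rfl⟩).hodgeClasses 2) :
    ofRatClass (ComplexPoints (Y ⊗ S)) (2 * 2) (BettiUniverse.crossMap Y S (show 1 + 3 = 2 * 2 by norm_num) t) ∈ algebraicClasses (Y ⊗ S) 2 := by
  haveI := BettiUniverse.finite hY 1
  haveI := BettiUniverse.finite hS 1
  haveI := BettiUniverse.finite hS 3
  obtain ⟨D⟩ := nonempty_kaehlerRationalDatum hS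
  -- hard Lefschetz on `S`: `L_η : H¹(S) ⥲ H³(S)(1)` as Hodge structures
  obtain ⟨f, hf, hfb⟩ := D.exists_hom_hodge_bijective_toLinearMap_eq_lefschetzPowTo hHD hS (t := 1) (k := 1) (m := 3) rfl rfl (by norm_num)
  set Φ := HodgeStructure.Hom.tensorMap (HodgeStructure.Hom.id (BettiUniverse.hodge hHD hY 1)) f with hΦ
  have hΦmap : Φ.toLinearMap = TensorProduct.map LinearMap.id (lefschetzPowTo D.η 1 1 3 rfl) := by
    rw [hΦ, HodgeStructure.Hom.tensorMap_toLinearMap, HodgeStructure.Hom.id_toLinearMap, hf]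
  have hΦb : Function.Bijective Φ.toLinearMap := by
    set E := TensorProduct.congr (LinearEquiv.refl ℚ (bettiCohomology Y 1)) (LinearEquiv.ofBijective f.toLinearMap hfb) with hE
    have hco : ⇑Φ.toLinearMap = ⇑E := by
      funext u
      induction u using TensorProduct.induction_on with
      | zero => rw [map_zero, map_zero]
      | tmul a b => rw [hΦ, HodgeStructure.Hom.tensorMap_toLinearMap, HodgeStructure.Hom.id_toLinearMap, TensorProduct.map_tmul, hE, TensorProduct.congr_tmul, LinearEquiv.refl_apply,
          LinearEquiv.ofBijective_apply, LinearMap.id_apply]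
      | add x y hx hy => rw [map_add, map_add, hx, hy]
    rw [hco]
    exact E.bijective
  -- `t` is the image of a Hodge class `u` of `H¹(Y) ⊗ H¹(S)`
  have ht' : t ∈ (((BettiUniverse.hodge hHD hY 1).tensor (BettiUniverse.hodge hHD hS 1)).hodgeClasses 1).map Φ.toLinearMap := by
    rw [Φ.map_hodgeClasses_eq_of_bijective hΦb 1, HodgeStructure.mem_hodgeClasses_iff, HodgeStructure.tensor_F]
    have e := HodgeStructure.tensorFiltration_tateTwist_right (BettiUniverse.hodge hHD hY 1) (BettiUniverse.hodge hHD hS 3) ((1 : ℕ) : ℤ) 1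
    rw [show (1 : ℤ) + ((1 : ℕ) : ℤ) = 2 by norm_num] at e
    change ofRat t ∈ (BettiUniverse.hodge hHD hY 1).tensorFiltration ((BettiUniverse.hodge hHD hS 3).tateTwist ((1 : ℕ) : ℤ)) 1
    rw [e]
    exact (HodgeStructure.mem_hodgeClasses_iff _ _ _).1 ht
  obtain ⟨u, hu, rfl⟩ := ht'
  rw [hΦmap, crossMap_map_id_lefschetz_right]
  -- both factors of the cup product are divisor classes
  have hη : D.η ∈ (BettiUniverse.hodge hHD hS (2 * 1)).hodgeClasses ((1 : ℕ) : ℤ) :=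
    (BettiUniverse.mem_hodgeClasses_hodge_iff_isOfHodgeType hHD hS 1 D.η).2 D.isOfHodgeType_Hη
  have hη' := (BettiUniverse.pullHodgeHom hHD hodgePQ_independent_of_hodgeModel_holds hYS hS (snd Y S) (2 * 1)).map_hodgeClasses_le ((1 : ℕ) : ℤ) ⟨D.η, hη, rfl⟩
  rw [BettiUniverse.pullHodgeHom_toLinearMap] at hη'
  have ha := (BettiUniverse.mem_hodgeClasses_hodge_iff_ofRatClass_mem_algebraicClasses hHD hYS (p := 1) (Or.inl le_rfl) _).1 hη'
  have hu' : BettiUniverse.crossMap Y S (rfl : 1 + 1 = 2) u ∈ (BettiUniverse.hodge hHD hYS 2).hodgeClasses 1 := by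
    refine BettiUniverse.crossMap_mem_hodgeClasses hHD hodgePQ_independent_of_hodgeModel_holds hY hS hYS (rfl : 1 + 1 = 2) 1 ?_
    rw [HodgeStructure.cast_hodgeClasses]
    exact hu
  have hb := (BettiUniverse.mem_hodgeClasses_hodge_two_iff_ofRatClass_mem_algebraicClasses_one hHD hYS _).1 hu'
  rw [BettiUniverse.ofRatClass_bettiCup]
  have halg := hcup ha hb
  exact halg

/-- **The Hodge classes of the Künneth piece `H¹(Y) ⊗ H³(S)` of `H⁴(Y × S)` are algebraic, granted Fulton's pull-back lemma `hF`** (which gives the cup-closure of the algebraic classes of `Y × S`, the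
tree's `cupProduct_algebraicClasses_of_fulton1998`). [cite: VoisinHodgeI2002, §6.2.3 Thm. 6.25 and Rem. 6.27, §11.3.1 Thm. 11.30, §11.3.3 Thm. 11.38–11.40 and p. 287] [cite: Fulton1998, §19.1 Prop. 19.1.2 and Cor. 19.2 (b)]
[cite: VoisinHodgeII2003, §9.2.2 Prop. 9.20–9.21] -/
theorem BettiUniverse.ofRatClass_crossMap_mem_algebraicClasses_of_hodge_one_tensor_three [HodgeTensorFacts.{0, 0}] (hF : fulton1998_map_mem_algebraicClasses) (hHD : exists_isReal_hodgeModel)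
    (hY : IsSmoothProjective m Y) (hS : IsSmoothProjective 2 S) (hYS : IsSmoothProjective d (Y ⊗ S)) {t : bettiCohomology Y 1 ⊗[ℚ] bettiCohomology S 3}
    (ht : t ∈ (BettiUniverse.kunnethSummand hHD hY hS (2 * 2) ⟨(1, 3), HasAntidiagonal.mem_antidiagonal.2 rfl⟩).hodgeClasses 2) :
    ofRatClass (ComplexPoints (Y ⊗ S)) (2 * 2) (BettiUniverse.crossMap Y S (show 1 + 3 = 2 * 2 by norm_num) t) ∈ algebraicClasses (Y ⊗ S) 2 :=
  BettiUniverse.ofRatClass_crossMap_mem_algebraicClasses_of_hodge_one_tensor_three_of_cupProduct hHD hY hS hYS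
    (fun _ _ hx hy ↦ cupProduct_algebraicClasses_of_fulton1998 hF hYS hx hy) ht

/-! ### §2 The piece `H³(S) ⊗ H¹(Z)` (`S` a surface) -/

/-- **`pr_S^*(η ∪ a) ∪ pr_Z^* b = pr_S^* η ∪ (pr_S^* a ∪ pr_Z^* b)`** extended linearly: `crossMap ∘ (L_η ⊗ id) = (pr_S^* η ∪ ·) ∘ crossMap` on `H¹(S;ℚ) ⊗ H¹(Z;ℚ)` (naturality and associativity of `∪`).
[cite: HatcherAT2002, §3.2 Prop. 3.10] [cite: VoisinHodgeI2002, §11.3.3 Thm. 11.38] -/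
private theorem crossMap_map_lefschetz_id_left (η : bettiCohomology S 2) (u : bettiCohomology S 1 ⊗[ℚ] bettiCohomology Z 1) :
    BettiUniverse.crossMap S Z (show 3 + 1 = 2 * 2 by norm_num) (TensorProduct.map (lefschetzPowTo η 1 1 3 rfl) LinearMap.id u) =
      bettiCup (show 2 + 2 = 2 * 2 by norm_num) (BettiUniverse.pull (fst S Z) 2 η) (BettiUniverse.crossMap S Z (rfl : 1 + 1 = 2) u) := by
  induction u using TensorProduct.induction_on with
  | zero => rw [map_zero, map_zero, map_zero, map_zero]
  | tmul a b =>
    rw [TensorProduct.map_tmul, LinearMap.id_apply, lefschetzPowTo_one_one_three_apply, BettiUniverse.crossMap_tmul, BettiUniverse.crossMap_tmul,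
      show BettiUniverse.pull (fst S Z) 3 (bettiCup (rfl : 2 + 1 = 3) η a) = bettiCup (rfl : 2 + 1 = 3) (BettiUniverse.pull (fst S Z) 2 η) (BettiUniverse.pull (fst S Z) 1 a) from
        bettiCup_map (fst S Z) rfl η a,
      bettiCup_assoc (rfl : 2 + 1 = 3) (rfl : 1 + 1 = 2) (show 3 + 1 = 2 * 2 by norm_num) (show 2 + 2 = 2 * 2 by norm_num)]
  | add x y hx hy => rw [map_add, map_add, hx, hy, map_add, map_add]

/-- **The Hodge classes of the Künneth piece `H³(S) ⊗ H¹(Z)` of `H⁴(S × Z)` are algebraic** (`S` a smooth projective surface, `Z` any smooth projective variety), granted the cup-closure `hcup` of the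
divisor classes of `S × Z`: the mirror of §1, with
`L_η ⊗ id : H¹(S) ⊗ H¹(Z) ⥲ H³(S)(1) ⊗ H¹(Z)` and `crossMap ((L_η ⊗ id) u) = pr_S^* η ∪ crossMap u`. [cite: VoisinHodgeI2002, §6.2.3 Thm. 6.25 and Rem. 6.27, §11.3.1 Thm. 11.30, §11.3.3 Thm. 11.38–11.40 and p. 287]
[cite: Fulton1998, §19.1 Prop. 19.1.2 and Cor. 19.2 (b)] [cite: VoisinHodgeII2003, §9.2.2 Prop. 9.20–9.21] -/
theorem BettiUniverse.ofRatClass_crossMap_mem_algebraicClasses_of_hodge_three_tensor_one_of_cupProduct [HodgeTensorFacts.{0, 0}] (hHD : exists_isReal_hodgeModel)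
    (hS : IsSmoothProjective 2 S) (hZ : IsSmoothProjective n Z) (hSZ : IsSmoothProjective d (S ⊗ Z))
    (hcup : ∀ ⦃x y : complexBetti (S ⊗ Z) (2 * 1)⦄, x ∈ algebraicClasses (S ⊗ Z) 1 → y ∈ algebraicClasses (S ⊗ Z) 1 →
      cupProduct (two_mul_add_two_mul 1 1) x y ∈ algebraicClasses (S ⊗ Z) (1 + 1))
    {t : bettiCohomology S 3 ⊗[ℚ] bettiCohomology Z 1} (ht : t ∈ (BettiUniverse.kunnethSummand hHD hS hZ (2 * 2) ⟨(3, 1), HasAntidiagonal.mem_antidiagonal.2 rfl⟩).hodgeClasses 2) :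
    ofRatClass (ComplexPoints (S ⊗ Z)) (2 * 2) (BettiUniverse.crossMap S Z (show 3 + 1 = 2 * 2 by norm_num) t) ∈ algebraicClasses (S ⊗ Z) 2 := by
  haveI := BettiUniverse.finite hZ 1
  haveI := BettiUniverse.finite hS 1
  haveI := BettiUniverse.finite hS 3
  obtain ⟨D⟩ := nonempty_kaehlerRationalDatum hS
  obtain ⟨f, hf, hfb⟩ := D.exists_hom_hodge_bijective_toLinearMap_eq_lefschetzPowTo hHD hS (t := 1) (k := 1) (m := 3) rfl rfl (by norm_num)
  set Φ := HodgeStructure.Hom.tensorMap f (HodgeStructure.Hom.id (BettiUniverse.hodge hHD hZ 1)) with hΦ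
  have hΦmap : Φ.toLinearMap = TensorProduct.map (lefschetzPowTo D.η 1 1 3 rfl) LinearMap.id := by
    rw [hΦ, HodgeStructure.Hom.tensorMap_toLinearMap, HodgeStructure.Hom.id_toLinearMap, hf]
  have hΦb : Function.Bijective Φ.toLinearMap := by
    set E := TensorProduct.congr (LinearEquiv.ofBijective f.toLinearMap hfb) (LinearEquiv.refl ℚ (bettiCohomology Z 1)) with hE
    have hco : ⇑Φ.toLinearMap = ⇑E := by
      funext u
      induction u using TensorProduct.induction_on with
      | zero => rw [map_zero, map_zero]
      | tmul a b => rw [hΦ, HodgeStructure.Hom.tensorMap_toLinearMap, HodgeStructure.Hom.id_toLinearMap, TensorProduct.map_tmul, hE, TensorProduct.congr_tmul, LinearEquiv.refl_apply,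
          LinearEquiv.ofBijective_apply, LinearMap.id_apply]
      | add x y hx hy => rw [map_add, map_add, hx, hy]
    rw [hco]
    exact E.bijective
  have ht' : t ∈ (((BettiUniverse.hodge hHD hS 1).tensor (BettiUniverse.hodge hHD hZ 1)).hodgeClasses 1).map Φ.toLinearMap := by
    rw [Φ.map_hodgeClasses_eq_of_bijective hΦb 1, HodgeStructure.mem_hodgeClasses_iff, HodgeStructure.tensor_F]
    have e := HodgeStructure.tensorFiltration_tateTwist_left (BettiUniverse.hodge hHD hS 3) (BettiUniverse.hodge hHD hZ 1) ((1 : ℕ) : ℤ) 1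
    rw [show (1 : ℤ) + ((1 : ℕ) : ℤ) = 2 by norm_num] at e
    change ofRat t ∈ ((BettiUniverse.hodge hHD hS 3).tateTwist ((1 : ℕ) : ℤ)).tensorFiltration (BettiUniverse.hodge hHD hZ 1) 1
    rw [e]
    exact (HodgeStructure.mem_hodgeClasses_iff _ _ _).1 ht
  obtain ⟨u, hu, rfl⟩ := ht'
  rw [hΦmap, crossMap_map_lefschetz_id_left]
  have hη : D.η ∈ (BettiUniverse.hodge hHD hS (2 * 1)).hodgeClasses ((1 : ℕ) : ℤ) :=
    (BettiUniverse.mem_hodgeClasses_hodge_iff_isOfHodgeType hHD hS 1 D.η).2 D.isOfHodgeType_Hη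
  have hη' := (BettiUniverse.pullHodgeHom hHD hodgePQ_independent_of_hodgeModel_holds hSZ hS (fst S Z) (2 * 1)).map_hodgeClasses_le ((1 : ℕ) : ℤ) ⟨D.η, hη, rfl⟩
  rw [BettiUniverse.pullHodgeHom_toLinearMap] at hη'
  have ha := (BettiUniverse.mem_hodgeClasses_hodge_iff_ofRatClass_mem_algebraicClasses hHD hSZ (p := 1) (Or.inl le_rfl) _).1 hη'
  have hu' : BettiUniverse.crossMap S Z (rfl : 1 + 1 = 2) u ∈ (BettiUniverse.hodge hHD hSZ 2).hodgeClasses 1 := by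
    refine BettiUniverse.crossMap_mem_hodgeClasses hHD hodgePQ_independent_of_hodgeModel_holds hS hZ hSZ (rfl : 1 + 1 = 2) 1 ?_
    rw [HodgeStructure.cast_hodgeClasses]
    exact hu
  have hb := (BettiUniverse.mem_hodgeClasses_hodge_two_iff_ofRatClass_mem_algebraicClasses_one hHD hSZ _).1 hu'
  rw [BettiUniverse.ofRatClass_bettiCup]
  have halg := hcup ha hb
  exact halg

/-- **The Hodge classes of the Künneth piece `H³(S) ⊗ H¹(Z)` of `H⁴(S × Z)` are algebraic, granted Fulton's pull-back lemma `hF`.** [cite: VoisinHodgeI2002, §6.2.3 Thm. 6.25 and Rem. 6.27, §11.3.1 Thm. 11.30, §11.3.3 Thm. 11.38–11.40 and p. 287]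
[cite: Fulton1998, §19.1 Prop. 19.1.2 and Cor. 19.2 (b)] [cite: VoisinHodgeII2003, §9.2.2 Prop. 9.20–9.21] -/
theorem BettiUniverse.ofRatClass_crossMap_mem_algebraicClasses_of_hodge_three_tensor_one [HodgeTensorFacts.{0, 0}] (hF : fulton1998_map_mem_algebraicClasses) (hHD : exists_isReal_hodgeModel)
    (hS : IsSmoothProjective 2 S) (hZ : IsSmoothProjective n Z) (hSZ : IsSmoothProjective d (S ⊗ Z)) {t : bettiCohomology S 3 ⊗[ℚ] bettiCohomology Z 1}
    (ht : t ∈ (BettiUniverse.kunnethSummand hHD hS hZ (2 * 2) ⟨(3, 1), HasAntidiagonal.mem_antidiagonal.2 rfl⟩).hodgeClasses 2) :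
    ofRatClass (ComplexPoints (S ⊗ Z)) (2 * 2) (BettiUniverse.crossMap S Z (show 3 + 1 = 2 * 2 by norm_num) t) ∈ algebraicClasses (S ⊗ Z) 2 :=
  BettiUniverse.ofRatClass_crossMap_mem_algebraicClasses_of_hodge_three_tensor_one_of_cupProduct hHD hS hZ hSZ
    (fun _ _ hx hy ↦ cupProduct_algebraicClasses_of_fulton1998 hF hSZ hx hy) ht

/-! ### §3 Two surfaces: `HC(S ⊗ S')` reduces to the piece `H²(S) ⊗ H²(S')` -/

/-- The end pieces: every class of `H⁰(S) ⊗ H⁴(S')` and of `H⁴(S) ⊗ H⁰(S')` maps to an algebraic class of `S × S'` (products of the point/fundamental classes, codimensions `0` and `2` on a surface).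
[cite: VoisinHodgeI2002, §11.3.3 p. 287 and Thm. 11.30] [cite: Deligne2000, §1] -/
private theorem ofRatClass_crossMap_mem_algebraicClasses_zero_four [HodgeTensorFacts.{0, 0}] (hHD : exists_isReal_hodgeModel) (hS : IsSmoothProjective 2 S) (hS' : IsSmoothProjective 2 S')
    (t : bettiCohomology S 0 ⊗[ℚ] bettiCohomology S' 4) :
    ofRatClass (ComplexPoints (S ⊗ S')) (2 * 2) (BettiUniverse.crossMap S S' (show 0 + 4 = 2 * 2 by norm_num) t) ∈ algebraicClasses (S ⊗ S') 2 := by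
  induction t using TensorProduct.induction_on with
  | zero => rw [map_zero, map_zero]; exact Submodule.zero_mem _
  | tmul e w =>
    have e0 : (BettiUniverse.hodge hHD hS (2 * 0)).hodgeClasses ((0 : ℕ) : ℤ) = ⊤ := BettiUniverse.hodgeClasses_hodge_zero_eq_top hHD hS
    have e4 : (BettiUniverse.hodge hHD hS' (2 * 2)).hodgeClasses ((2 : ℕ) : ℤ) = ⊤ := BettiUniverse.hodgeClasses_hodge_top_eq_top hHD hS'
    have he : ofRatClass (ComplexPoints S) (2 * 0) e ∈ algebraicClasses S 0 :=
      (BettiUniverse.mem_hodgeClasses_hodge_iff_ofRatClass_mem_algebraicClasses hHD hS (p := 0) (Or.inl (by norm_num)) e).1 (by rw [e0]; exact Submodule.mem_top)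
    have hw : ofRatClass (ComplexPoints S') (2 * 2) w ∈ algebraicClasses S' 2 :=
      (BettiUniverse.mem_hodgeClasses_hodge_iff_ofRatClass_mem_algebraicClasses hHD hS' (p := 2) (Or.inr (by norm_num)) w).1 (by rw [e4]; exact Submodule.mem_top)
    have halg := BettiUniverse.ofRatClass_crossMap_tmul_mem_algebraicClasses hS hS' he hw
    exact halg
  | add x y hx hy => rw [map_add, map_add]; exact Submodule.add_mem _ hx hy

/-- The other end piece `H⁴(S) ⊗ H⁰(S')`. [cite: VoisinHodgeI2002, §11.3.3 p. 287 and Thm. 11.30] [cite: Deligne2000, §1] -/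
private theorem ofRatClass_crossMap_mem_algebraicClasses_four_zero [HodgeTensorFacts.{0, 0}] (hHD : exists_isReal_hodgeModel) (hS : IsSmoothProjective 2 S) (hS' : IsSmoothProjective 2 S')
    (t : bettiCohomology S 4 ⊗[ℚ] bettiCohomology S' 0) :
    ofRatClass (ComplexPoints (S ⊗ S')) (2 * 2) (BettiUniverse.crossMap S S' (show 4 + 0 = 2 * 2 by norm_num) t) ∈ algebraicClasses (S ⊗ S') 2 := by
  induction t using TensorProduct.induction_on with
  | zero => rw [map_zero, map_zero]; exact Submodule.zero_mem _
  | tmul w e =>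
    have e4 : (BettiUniverse.hodge hHD hS (2 * 2)).hodgeClasses ((2 : ℕ) : ℤ) = ⊤ := BettiUniverse.hodgeClasses_hodge_top_eq_top hHD hS
    have e0 : (BettiUniverse.hodge hHD hS' (2 * 0)).hodgeClasses ((0 : ℕ) : ℤ) = ⊤ := BettiUniverse.hodgeClasses_hodge_zero_eq_top hHD hS'
    have hw : ofRatClass (ComplexPoints S) (2 * 2) w ∈ algebraicClasses S 2 :=
      (BettiUniverse.mem_hodgeClasses_hodge_iff_ofRatClass_mem_algebraicClasses hHD hS (p := 2) (Or.inr (by norm_num)) w).1 (by rw [e4]; exact Submodule.mem_top)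
    have he : ofRatClass (ComplexPoints S') (2 * 0) e ∈ algebraicClasses S' 0 :=
      (BettiUniverse.mem_hodgeClasses_hodge_iff_ofRatClass_mem_algebraicClasses hHD hS' (p := 0) (Or.inl (by norm_num)) e).1 (by rw [e0]; exact Submodule.mem_top)
    have halg := BettiUniverse.ofRatClass_crossMap_tmul_mem_algebraicClasses hS hS' hw he
    exact halg
  | add x y hx hy => rw [map_add, map_add]; exact Submodule.add_mem _ hx hy

/-- **`HC(S ⊗ S')` for two smooth projective surfaces, granted the cup-closure `hcup` of the divisor classes of `S × S'`, as soon as the Hodge classes of the Künneth piece `H²(S) ⊗ H²(S')` map to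
algebraic classes of `S × S'`**: the Hodge classes of
`H⁴(S × S')` are the sums of the cross products of the Hodge classes of the five pieces (Thm. 11.38/11.40, the lane's `exists_eq_kunnethMap_of_mem_hodgeClasses`); the pieces `H⁰⊗H⁴`, `H⁴⊗H⁰` are
products of algebraic classes, `H¹⊗H³` and `H³⊗H¹` are algebraic by §1–§2, and `HC(S ⊗ S') ⟺ HC²(S ⊗ S')` (codimensions `0, 1, 3, 4` are free). [cite: VoisinHodgeI2002, §11.3.3 Thm. 11.38, Thm. 11.40,
Lemma 11.41 and p. 287, §11.3.1 Thm. 11.30, §6.2.3 Thm. 6.25] [cite: Deligne2000, §1] [cite: Fulton1998, §19.1 Prop. 19.1.2 and Cor. 19.2 (b)] -/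
theorem BettiUniverse.hodgeConjectureFor_tensor_surfaces_of_kunneth_two_two_of_cupProduct [HodgeTensorFacts.{0, 0}] (hHD : exists_isReal_hodgeModel)
    (hS : IsSmoothProjective 2 S) (hS' : IsSmoothProjective 2 S') (hSS' : IsSmoothProjective 4 (S ⊗ S'))
    (hcup : ∀ ⦃x y : complexBetti (S ⊗ S') (2 * 1)⦄, x ∈ algebraicClasses (S ⊗ S') 1 → y ∈ algebraicClasses (S ⊗ S') 1 →
      cupProduct (two_mul_add_two_mul 1 1) x y ∈ algebraicClasses (S ⊗ S') (1 + 1))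
    (halg : ∀ t ∈ (BettiUniverse.kunnethSummand hHD hS hS' (2 * 2) ⟨(2, 2), HasAntidiagonal.mem_antidiagonal.2 rfl⟩).hodgeClasses 2,
      ofRatClass (ComplexPoints (S ⊗ S')) (2 * 2) (BettiUniverse.crossMap S S' (show 2 + 2 = 2 * 2 by norm_num) t) ∈ algebraicClasses (S ⊗ S') 2) :
    HodgeConjectureFor 4 (S ⊗ S') := by
  refine (hodgeConjectureFor_iff_codim_two_of_dim_eq_four hSS').2 fun c hc hcH ↦ ?_
  obtain ⟨v, rfl⟩ := (isRationalClass_iff_mem_range_ofRatClass c).1 hc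
  have hv : v ∈ (BettiUniverse.hodge hHD hSS' (2 * 2)).hodgeClasses 2 := (BettiUniverse.mem_hodgeClasses_hodge_iff_isOfHodgeType hHD hSS' 2 v).2 hcH
  obtain ⟨t, ⟨ht, rfl⟩, -⟩ := BettiUniverse.exists_eq_kunnethMap_of_mem_hodgeClasses hHD hodgePQ_independent_of_hodgeModel_holds hS hS' hSS' (2 * 2) 2 hv
  rw [map_sum]
  refine Submodule.sum_mem _ fun ij _ ↦ ?_
  obtain ⟨⟨i, j⟩, hij⟩ := ij
  have hij' : i + j = 4 := HasAntidiagonal.mem_antidiagonal.1 hij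
  have hcases : i = 0 ∧ j = 4 ∨ i = 1 ∧ j = 3 ∨ i = 2 ∧ j = 2 ∨ i = 3 ∧ j = 1 ∨ i = 4 ∧ j = 0 := by omega
  rcases hcases with ⟨rfl, rfl⟩ | ⟨rfl, rfl⟩ | ⟨rfl, rfl⟩ | ⟨rfl, rfl⟩ | ⟨rfl, rfl⟩
  · have h04 := ofRatClass_crossMap_mem_algebraicClasses_zero_four hHD hS hS' (t ⟨(0, 4), hij⟩)
    exact h04
  · have h13 := BettiUniverse.ofRatClass_crossMap_mem_algebraicClasses_of_hodge_one_tensor_three_of_cupProduct hHD hS hS' hSS' hcup (ht ⟨(1, 3), hij⟩)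
    exact h13
  · have h22 := halg _ (ht ⟨(2, 2), hij⟩)
    exact h22
  · have h31 := BettiUniverse.ofRatClass_crossMap_mem_algebraicClasses_of_hodge_three_tensor_one_of_cupProduct hHD hS hS' hSS' hcup (ht ⟨(3, 1), hij⟩)
    exact h31
  · have h40 := ofRatClass_crossMap_mem_algebraicClasses_four_zero hHD hS hS' (t ⟨(4, 0), hij⟩)
    exact h40

/-- **`HC(S ⊗ S')` for two smooth projective surfaces, granted `hF`, as soon as the Hodge classes of the Künneth piece `H²(S) ⊗ H²(S')` map to algebraic classes of `S × S'`.**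
[cite: VoisinHodgeI2002, §11.3.3 Thm. 11.38, Thm. 11.40, Lemma 11.41 and p. 287, §11.3.1 Thm. 11.30, §6.2.3 Thm. 6.25] [cite: Deligne2000, §1] [cite: Fulton1998, §19.1 Prop. 19.1.2 and Cor. 19.2 (b)] -/
theorem BettiUniverse.hodgeConjectureFor_tensor_surfaces_of_kunneth_two_two [HodgeTensorFacts.{0, 0}] (hF : fulton1998_map_mem_algebraicClasses) (hHD : exists_isReal_hodgeModel)
    (hS : IsSmoothProjective 2 S) (hS' : IsSmoothProjective 2 S') (hSS' : IsSmoothProjective 4 (S ⊗ S'))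
    (halg : ∀ t ∈ (BettiUniverse.kunnethSummand hHD hS hS' (2 * 2) ⟨(2, 2), HasAntidiagonal.mem_antidiagonal.2 rfl⟩).hodgeClasses 2,
      ofRatClass (ComplexPoints (S ⊗ S')) (2 * 2) (BettiUniverse.crossMap S S' (show 2 + 2 = 2 * 2 by norm_num) t) ∈ algebraicClasses (S ⊗ S') 2) :
    HodgeConjectureFor 4 (S ⊗ S') :=
  BettiUniverse.hodgeConjectureFor_tensor_surfaces_of_kunneth_two_two_of_cupProduct hHD hS hS' hSS' (fun _ _ hx hy ↦ cupProduct_algebraicClasses_of_fulton1998 hF hSS' hx hy) halg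

/-- **`HC(S ⊗ S')` for two surfaces with `dim_ℚ Hom_HS(H²(S), H²(S')) ≤ ρ(S)ρ(S')`, granted the cup-closure `hcup` of the divisor classes of `S × S'`** — g27-#9's `hodgeConjectureFor_tensor_surfaces_of_hom`
WITHOUT its conditions on `H¹ ⊗ H³` and `H³ ⊗ H¹`:
then the Hodge classes of `H²(S) ⊗ H²(S')` (as many as `dim Hom_HS(H²S, H²S')`, g27-#7) are spanned by the `ρρ'` products of divisor classes, which are algebraic.
[cite: VoisinHodgeI2002, §11.3.3 Lemma 11.41, p. 287, Thm. 11.30 and §6.2.3 Thm. 6.25] [cite: Deligne2000, §1] [cite: Fulton1998, §19.1 Prop. 19.1.2 and Cor. 19.2 (b)] -/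
theorem BettiUniverse.hodgeConjectureFor_tensor_surfaces_of_finrank_hom_le_of_cupProduct (hHD : exists_isReal_hodgeModel) (hS : IsSmoothProjective 2 S) (hS' : IsSmoothProjective 2 S')
    (hSS' : IsSmoothProjective 4 (S ⊗ S'))
    (hcup : ∀ ⦃x y : complexBetti (S ⊗ S') (2 * 1)⦄, x ∈ algebraicClasses (S ⊗ S') 1 → y ∈ algebraicClasses (S ⊗ S') 1 →
      cupProduct (two_mul_add_two_mul 1 1) x y ∈ algebraicClasses (S ⊗ S') (1 + 1))
    (h22 : Module.finrank ℚ (HodgeStructure.Hom (BettiUniverse.hodge hHD hS 2) (BettiUniverse.hodge hHD hS' 2)) ≤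
      Module.finrank ℚ ↥((BettiUniverse.hodge hHD hS 2).hodgeClasses 1) * Module.finrank ℚ ↥((BettiUniverse.hodge hHD hS' 2).hodgeClasses 1)) :
    HodgeConjectureFor 4 (S ⊗ S') := by
  haveI : HodgeTensorFacts.{0, 0} := hodgeTensorFacts_holds
  haveI := BettiUniverse.finite hS 2
  haveI := BettiUniverse.finite hS' 2
  refine BettiUniverse.hodgeConjectureFor_tensor_surfaces_of_kunneth_two_two_of_cupProduct hHD hS hS' hSS' hcup fun t ht ↦ ?_
  -- the products of divisor classes exhaust the Hodge classes of `H²(S) ⊗ H²(S')`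
  set P : Submodule ℚ (bettiCohomology S 2 ⊗[ℚ] bettiCohomology S' 2) :=
    LinearMap.range (TensorProduct.mapIncl ((BettiUniverse.hodge hHD hS 2).hodgeClasses 1) ((BettiUniverse.hodge hHD hS' 2).hodgeClasses 1)) with hP
  have hPle : P ≤ ((BettiUniverse.hodge hHD hS 2).tensor (BettiUniverse.hodge hHD hS' 2)).hodgeClasses (1 + 1) := by
    rw [hP, TensorProduct.range_mapIncl, Submodule.map₂_le]
    exact fun y hy z hz ↦ HodgeStructure.tmul_mem_hodgeClasses_tensor _ _ hy hz
  haveI : Module.Free ℚ ↥((BettiUniverse.hodge hHD hS 2).hodgeClasses 1) := Module.Free.of_divisionRing ℚ _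
  haveI : Module.Free ℚ ↥((BettiUniverse.hodge hHD hS' 2).hodgeClasses 1) := Module.Free.of_divisionRing ℚ _
  have hPrank : Module.finrank ℚ ↥P = Module.finrank ℚ ↥((BettiUniverse.hodge hHD hS 2).hodgeClasses 1) * Module.finrank ℚ ↥((BettiUniverse.hodge hHD hS' 2).hodgeClasses 1) := by
    rw [hP, LinearMap.finrank_range_of_inj (Module.Flat.tensorProduct_mapIncl_injective_of_right _ _), Module.finrank_tensorProduct]
  have hHrank : Module.finrank ℚ ↥(((BettiUniverse.hodge hHD hS 2).tensor (BettiUniverse.hodge hHD hS' 2)).hodgeClasses (1 + 1)) =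
      Module.finrank ℚ (HodgeStructure.Hom (BettiUniverse.hodge hHD hS 2) (BettiUniverse.hodge hHD hS' 2)) := by
    rw [show (1 : ℤ) + 1 = ((2 : ℕ) : ℤ) by norm_num]
    exact BettiUniverse.finrank_hodgeClasses_tensor_hodge_eq_finrank_hom hHD hS hS' 2
  have hPeq : P = ((BettiUniverse.hodge hHD hS 2).tensor (BettiUniverse.hodge hHD hS' 2)).hodgeClasses (1 + 1) :=
    Submodule.eq_of_le_of_finrank_le hPle (by rw [hHrank, hPrank]; exact h22)
  have ht' : t ∈ P := by
    rw [hPeq, show (1 : ℤ) + 1 = 2 by norm_num]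
    exact ht
  rw [hP] at ht'
  obtain ⟨w, rfl⟩ := ht'
  clear ht
  induction w using TensorProduct.induction_on with
  | zero => rw [map_zero, map_zero, map_zero]; exact Submodule.zero_mem _
  | tmul p q =>
    rw [TensorProduct.mapIncl, TensorProduct.map_tmul, Submodule.subtype_apply, Submodule.subtype_apply]
    have hpq := BettiUniverse.ofRatClass_crossMap_tmul_mem_algebraicClasses hS hS' ((BettiUniverse.mem_hodgeClasses_hodge_two_iff_ofRatClass_mem_algebraicClasses_one hHD hS _).1 p.2)
      ((BettiUniverse.mem_hodgeClasses_hodge_two_iff_ofRatClass_mem_algebraicClasses_one hHD hS' _).1 q.2)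
    exact hpq
  | add x y hx hy => rw [map_add, map_add, map_add]; exact Submodule.add_mem _ hx hy

/-- **`HC(S ⊗ S')` for two surfaces with `dim_ℚ Hom_HS(H²(S), H²(S')) ≤ ρ(S)ρ(S')`, granted `hF`** (g27-#9's theorem without its `H¹ ⊗ H³` conditions).
[cite: VoisinHodgeI2002, §11.3.3 Lemma 11.41, p. 287, Thm. 11.30 and §6.2.3 Thm. 6.25] [cite: Deligne2000, §1] [cite: Fulton1998, §19.1 Prop. 19.1.2 and Cor. 19.2 (b)] -/
theorem BettiUniverse.hodgeConjectureFor_tensor_surfaces_of_finrank_hom_le_of_fulton (hF : fulton1998_map_mem_algebraicClasses) (hHD : exists_isReal_hodgeModel) (hS : IsSmoothProjective 2 S)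
    (hS' : IsSmoothProjective 2 S') (hSS' : IsSmoothProjective 4 (S ⊗ S'))
    (h22 : Module.finrank ℚ (HodgeStructure.Hom (BettiUniverse.hodge hHD hS 2) (BettiUniverse.hodge hHD hS' 2)) ≤
      Module.finrank ℚ ↥((BettiUniverse.hodge hHD hS 2).hodgeClasses 1) * Module.finrank ℚ ↥((BettiUniverse.hodge hHD hS' 2).hodgeClasses 1)) :
    HodgeConjectureFor 4 (S ⊗ S') :=
  BettiUniverse.hodgeConjectureFor_tensor_surfaces_of_finrank_hom_le_of_cupProduct hHD hS hS' hSS' (fun _ _ hx hy ↦ cupProduct_algebraicClasses_of_fulton1998 hF hSS' hx hy) h22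

/-- **`HC(S ⊗ S')` when `p_g(S) = 0`, granted `hF`** — no condition on `q(S)`, `q(S')`, `p_g(S')`: `H²(S)` is purely of type `(1,1)` (all of `H²(S;ℚ)` is divisor classes), so the Hodge classes of
`H²(S) ⊗ H²(S')` are `H²(S) ⊗ NS(S')_ℚ` (Deligne 2.1.13), products of divisor classes. [cite: VoisinHodgeI2002, §11.3.3 Lemma 11.41, p. 287, Thm. 11.30, §6.2.3 Thm. 6.25 and §6.1.3 Cor. 6.13] [cite: DeligneHodgeII1971, 2.1.13]
[cite: Deligne2000, §1] [cite: Fulton1998, §19.1 Prop. 19.1.2 and Cor. 19.2 (b)] -/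
theorem BettiUniverse.hodgeConjectureFor_tensor_surfaces_of_pg_zero_left_of_fulton (hF : fulton1998_map_mem_algebraicClasses) (hHD : exists_isReal_hodgeModel) (hS : IsSmoothProjective 2 S)
    (hS' : IsSmoothProjective 2 S') (hSS' : IsSmoothProjective 4 (S ⊗ S')) (hpg : (BettiUniverse.hodge hHD hS 2).hodgeNumber 2 0 = 0) : HodgeConjectureFor 4 (S ⊗ S') := by
  haveI : HodgeTensorFacts.{0, 0} := hodgeTensorFacts_holds
  haveI := BettiUniverse.finite hS 2
  haveI := BettiUniverse.finite hS' 2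
  have htop : (BettiUniverse.hodge hHD hS 2).hodgeClasses 1 = ⊤ := (BettiUniverse.hodgeClasses_hodge_two_eq_top_iff hHD hS).2 hpg
  refine BettiUniverse.hodgeConjectureFor_tensor_surfaces_of_kunneth_two_two hF hHD hS hS' hSS' fun t ht ↦ ?_
  have hspan := HodgeStructure.hodgeClasses_tensor_eq_span_of_hodgeClasses_eq_top (BettiUniverse.hodge hHD hS 2) htop (by norm_num) (BettiUniverse.hodge hHD hS' 2) 1
  rw [show (1 : ℤ) + 1 = 2 by norm_num] at hspan
  have hle : Submodule.span ℚ (Set.image2 (fun u w ↦ u ⊗ₜ[ℚ] w) Set.univ (((BettiUniverse.hodge hHD hS' 2).hodgeClasses 1 : Set (bettiCohomology S' 2)))) ≤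
      LinearMap.range (TensorProduct.mapIncl (⊤ : Submodule ℚ (bettiCohomology S 2)) ((BettiUniverse.hodge hHD hS' 2).hodgeClasses 1)) :=
    Submodule.span_le.2 (by
      rintro _ ⟨u, -, w, hw, rfl⟩
      exact ⟨(⟨u, Submodule.mem_top⟩ : ↥(⊤ : Submodule ℚ (bettiCohomology S 2))) ⊗ₜ[ℚ] (⟨w, hw⟩ : ↥((BettiUniverse.hodge hHD hS' 2).hodgeClasses 1)),
        by rw [TensorProduct.mapIncl, TensorProduct.map_tmul]; rfl⟩)
  have ht' : t ∈ LinearMap.range (TensorProduct.mapIncl (⊤ : Submodule ℚ (bettiCohomology S 2)) ((BettiUniverse.hodge hHD hS' 2).hodgeClasses 1)) := by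
    refine hle ?_
    rw [← hspan]
    exact ht
  obtain ⟨w, rfl⟩ := ht'
  clear ht
  induction w using TensorProduct.induction_on with
  | zero => rw [map_zero, map_zero, map_zero]; exact Submodule.zero_mem _
  | tmul p q =>
    rw [TensorProduct.mapIncl, TensorProduct.map_tmul, Submodule.subtype_apply, Submodule.subtype_apply]
    have hu : (p : bettiCohomology S 2) ∈ (BettiUniverse.hodge hHD hS 2).hodgeClasses 1 := by rw [htop]; exact Submodule.mem_top
    have hpq := BettiUniverse.ofRatClass_crossMap_tmul_mem_algebraicClasses hS hS' ((BettiUniverse.mem_hodgeClasses_hodge_two_iff_ofRatClass_mem_algebraicClasses_one hHD hS _).1 hu)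
      ((BettiUniverse.mem_hodgeClasses_hodge_two_iff_ofRatClass_mem_algebraicClasses_one hHD hS' _).1 q.2)
    exact hpq
  | add x y hx hy => rw [map_add, map_add, map_add]; exact Submodule.add_mem _ hx hy

/-- **`HC(S ⊗ S')` when `p_g(S') = 0`, granted `hF`** (the mirror statement: the Hodge classes of `H²(S) ⊗ H²(S')` are `NS(S)_ℚ ⊗ H²(S')`). [cite: VoisinHodgeI2002, §11.3.3 Lemma 11.41, p. 287, Thm. 11.30 and §6.2.3 Thm. 6.25]
[cite: DeligneHodgeII1971, 2.1.13] [cite: Deligne2000, §1] [cite: Fulton1998, §19.1 Prop. 19.1.2 and Cor. 19.2 (b)] -/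
theorem BettiUniverse.hodgeConjectureFor_tensor_surfaces_of_pg_zero_right_of_fulton (hF : fulton1998_map_mem_algebraicClasses) (hHD : exists_isReal_hodgeModel) (hS : IsSmoothProjective 2 S)
    (hS' : IsSmoothProjective 2 S') (hSS' : IsSmoothProjective 4 (S ⊗ S')) (hpg : (BettiUniverse.hodge hHD hS' 2).hodgeNumber 2 0 = 0) : HodgeConjectureFor 4 (S ⊗ S') := by
  haveI : HodgeTensorFacts.{0, 0} := hodgeTensorFacts_holds
  haveI := BettiUniverse.finite hS 2
  haveI := BettiUniverse.finite hS' 2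
  have htop : (BettiUniverse.hodge hHD hS' 2).hodgeClasses 1 = ⊤ := (BettiUniverse.hodgeClasses_hodge_two_eq_top_iff hHD hS').2 hpg
  refine BettiUniverse.hodgeConjectureFor_tensor_surfaces_of_kunneth_two_two hF hHD hS hS' hSS' fun t ht ↦ ?_
  have hspan := HodgeStructure.hodgeClasses_tensor_eq_span_of_hodgeClasses_eq_top_right (BettiUniverse.hodge hHD hS 2) 1 (BettiUniverse.hodge hHD hS' 2) htop (by norm_num)
  rw [show (1 : ℤ) + 1 = 2 by norm_num] at hspan
  have hle : Submodule.span ℚ (Set.image2 (fun w u ↦ w ⊗ₜ[ℚ] u) (((BettiUniverse.hodge hHD hS 2).hodgeClasses 1 : Set (bettiCohomology S 2))) Set.univ) ≤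
      LinearMap.range (TensorProduct.mapIncl ((BettiUniverse.hodge hHD hS 2).hodgeClasses 1) (⊤ : Submodule ℚ (bettiCohomology S' 2))) :=
    Submodule.span_le.2 (by
      rintro _ ⟨w, hw, u, -, rfl⟩
      exact ⟨(⟨w, hw⟩ : ↥((BettiUniverse.hodge hHD hS 2).hodgeClasses 1)) ⊗ₜ[ℚ] (⟨u, Submodule.mem_top⟩ : ↥(⊤ : Submodule ℚ (bettiCohomology S' 2))),
        by rw [TensorProduct.mapIncl, TensorProduct.map_tmul]; rfl⟩)
  have ht' : t ∈ LinearMap.range (TensorProduct.mapIncl ((BettiUniverse.hodge hHD hS 2).hodgeClasses 1) (⊤ : Submodule ℚ (bettiCohomology S' 2))) := by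
    refine hle ?_
    rw [← hspan]
    exact ht
  obtain ⟨w, rfl⟩ := ht'
  clear ht
  induction w using TensorProduct.induction_on with
  | zero => rw [map_zero, map_zero, map_zero]; exact Submodule.zero_mem _
  | tmul p q =>
    rw [TensorProduct.mapIncl, TensorProduct.map_tmul, Submodule.subtype_apply, Submodule.subtype_apply]
    have hu : (q : bettiCohomology S' 2) ∈ (BettiUniverse.hodge hHD hS' 2).hodgeClasses 1 := by rw [htop]; exact Submodule.mem_top
    have hpq := BettiUniverse.ofRatClass_crossMap_tmul_mem_algebraicClasses hS hS' ((BettiUniverse.mem_hodgeClasses_hodge_two_iff_ofRatClass_mem_algebraicClasses_one hHD hS _).1 p.2)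
      ((BettiUniverse.mem_hodgeClasses_hodge_two_iff_ofRatClass_mem_algebraicClasses_one hHD hS' _).1 hu)
    exact hpq
  | add x y hx hy => rw [map_add, map_add, map_add]; exact Submodule.add_mem _ hx hy

/-- **`HC(S ⊗ S)` for every smooth projective surface with `p_g(S) = 0`, granted `hF`** (ruled surfaces over a curve of any genus, bielliptic surfaces, Enriques, Godeaux, … — the irregularity plays no
role). [cite: VoisinHodgeI2002, §11.3.3 Lemma 11.41, p. 287, Thm. 11.30 and §6.2.3 Thm. 6.25] [cite: Deligne2000, §1] [cite: Fulton1998, §19.1 Prop. 19.1.2 and Cor. 19.2 (b)] -/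
theorem BettiUniverse.hodgeConjectureFor_tensor_self_of_pg_zero_of_fulton (hF : fulton1998_map_mem_algebraicClasses) (hHD : exists_isReal_hodgeModel) (hS : IsSmoothProjective 2 S)
    (hSS : IsSmoothProjective 4 (S ⊗ S)) (hpg : (BettiUniverse.hodge hHD hS 2).hodgeNumber 2 0 = 0) : HodgeConjectureFor 4 (S ⊗ S) :=
  BettiUniverse.hodgeConjectureFor_tensor_surfaces_of_pg_zero_left_of_fulton hF hHD hS hS hSS hpg

/-! ### §4 Products of two abelian surfaces: unconditional (the cup product of algebraic classes of an abelian variety is algebraic) -/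

/-- **`HC(A × A')` for two abelian SURFACES with `dim_ℚ Hom_HS(H²(A), H²(A')) ≤ ρ(A)ρ(A')`** — UNCONDITIONALLY: on the abelian variety `A × A'` the cup product of algebraic classes is algebraic
(the tree's `AbelianVariety.cupProduct_mem_algebraicClasses`, Voisin II Prop. 9.20 via translations), so §3 applies without Fulton's lemma; e.g. two abelian surfaces whose transcendental
`ℚ`-Hodge structures `T(A)`, `T(A')` admit no non-zero morphism. [cite: VoisinHodgeI2002, §11.3.3 Lemma 11.41, p. 287, Thm. 11.30 and §6.2.3 Thm. 6.25] [cite: VoisinHodgeII2003, §9.2.2 Prop. 9.20–9.21]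
[cite: Deligne2000, §1] -/
theorem AbelianVariety.hodgeConjectureFor_prod_surfaces_of_finrank_hom_le (A A' : Motives.AbelianVariety ℂ) (hHD : exists_isReal_hodgeModel) (hA : IsSmoothProjective 2 A.X)
    (hA' : IsSmoothProjective 2 A'.X) (hAA' : IsSmoothProjective 4 (A.X ⊗ A'.X))
    (h22 : Module.finrank ℚ (HodgeStructure.Hom (BettiUniverse.hodge hHD hA 2) (BettiUniverse.hodge hHD hA' 2)) ≤
      Module.finrank ℚ ↥((BettiUniverse.hodge hHD hA 2).hodgeClasses 1) * Module.finrank ℚ ↥((BettiUniverse.hodge hHD hA' 2).hodgeClasses 1)) :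
    HodgeConjectureFor 4 (A.X ⊗ A'.X) :=
  BettiUniverse.hodgeConjectureFor_tensor_surfaces_of_finrank_hom_le_of_cupProduct hHD hA hA' hAA'
    (fun _ _ hx hy ↦ AbelianVariety.cupProduct_mem_algebraicClasses (A.prod A') hx hy) h22

/-- **`HC(A × A')` for two abelian surfaces as soon as the Hodge classes of `H²(A) ⊗ H²(A')` map to algebraic classes** (unconditional form of §3's first theorem).
[cite: VoisinHodgeI2002, §11.3.3 Thm. 11.38, Thm. 11.40 and p. 287, §6.2.3 Thm. 6.25] [cite: VoisinHodgeII2003, §9.2.2 Prop. 9.20–9.21] [cite: Deligne2000, §1] -/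
theorem AbelianVariety.hodgeConjectureFor_prod_surfaces_of_kunneth_two_two [HodgeTensorFacts.{0, 0}] (A A' : Motives.AbelianVariety ℂ) (hHD : exists_isReal_hodgeModel)
    (hA : IsSmoothProjective 2 A.X) (hA' : IsSmoothProjective 2 A'.X) (hAA' : IsSmoothProjective 4 (A.X ⊗ A'.X))
    (halg : ∀ t ∈ (BettiUniverse.kunnethSummand hHD hA hA' (2 * 2) ⟨(2, 2), HasAntidiagonal.mem_antidiagonal.2 rfl⟩).hodgeClasses 2,
      ofRatClass (ComplexPoints (A.X ⊗ A'.X)) (2 * 2) (BettiUniverse.crossMap A.X A'.X (show 2 + 2 = 2 * 2 by norm_num) t) ∈ algebraicClasses (A.X ⊗ A'.X) 2) :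
    HodgeConjectureFor 4 (A.X ⊗ A'.X) :=
  BettiUniverse.hodgeConjectureFor_tensor_surfaces_of_kunneth_two_two_of_cupProduct hHD hA hA' hAA'
    (fun _ _ hx hy ↦ AbelianVariety.cupProduct_mem_algebraicClasses (A.prod A') hx hy) halg

end Literature.AlgebraicGeometry.HodgeTheory

end
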